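import Summits.CriticalPhenomena.PercolationContinuityZ3.Theorems.PercNearOneGluingNoHeavySamePWitnessZd
import Summits.CriticalPhenomena.PercolationContinuityZ3.Theorems.Transplant.SiteSamePWitnessAtOne
import HarnessLib

/-!
# The BOND same-`p` witness AT DENSITY ONE on any graph carrying a planar macro-lattice; `SameP.SamePWitness (zdGraph d) 0` holds, `d ≥ 3`
# (lane `prim-bschramm`, seat p1 gen 4)

builds on p205010 (kernel theorem, internal audit signed; external expert review pending).

The bond input `SameP.SamePWitness G x` (`PercNearOneGluingNoHeavySamePDefs.lean`, p4) asks for a lawful bounded-range history-driven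
scheme at EVERY density `p` with `θ_x(p) > 0`, including `p = 1`, where Kozma–Nitzan's construction is not available (the caveat of
`P4-GENERAL.md` §2.4/§7, which produced `SameP.SamePWitnessLtOne` and `samePWitnessLtOne_zd`).  This file removes the caveat by the bond twin of
the site device of `Transplant/SiteSamePWitnessAtOne.lean`: given ANY map `ι : ℤ² → V` that is injective and carries the unit steps of the
macro-lattice to edges of `G` (a planar macro-lattice through `x = ι 0`), the SINGLE-EDGE EXPLORATION SCHEME examines the macro-vertex `v = tgt e`
from its occupied neighbour `e.1` by revealing the one edge `{ι e.1, ι v}` and succeeds iff it is open.  It is lawful on `G` at `(p, 1 - p)` for every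
`p`, has envelopes of at most one edge and `U₀ = ∅`, and its occupied macro-cluster is carried by `ι` into the open cluster of `x` — so an infinite
final macro-cluster forces `x ↔ ∞` surely.  Hence the witness clause at every `p` with `1 - p < 2⁻³²`, `SamePWitnessLtOne G (ι 0) → SamePWitness G (ι 0)`,
and with `samePWitnessLtOne_zd` and the planar embedding `SiteSameP.planarEmb`: **`samePWitness_zd (hd : 3 ≤ d) : SameP.SamePWitness (zdGraph d) 0`**.

* `edgeScheme G ι` and `edgeScheme_lawful : (edgeScheme G ι hadj).Lawful G p (1 - p)`; `card_env_le_one`; `run_inv`; `mem_percolatesAt_of_infinite`;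
* `samePWitness_clause_of_near_one`, **`samePWitness_of_ltOne`**, `samePWitness_iff_ltOne`;
* **`samePWitness_zd (hd : 3 ≤ d)`** — the unrestricted input (FSW) HOLDS for `ℤ^d`, `d ≥ 3`.
Helper file (`--supports stmt-CriticalPhenomena-4575`); plain definitions + proofs, no sorries, no named-fact hypotheses.
[cite: KozmaNitzan2024, §4 p. 25 (Definition of an exploration process, (1)–(5))] [cite: GrimmettPercolation1999, §1.3]
-/

noncomputable section

namespace Summit.CriticalPhenomena.PercolationContinuityZ3.Theorems.Transplant

namespace SamePAtOne

open MeasureTheory Literature.Probability.Percolation Literature.Probability.LatticeModels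
open Literature.Probability.Percolation.GadgetSystem (tgt)
open HSiteScheme ProbeHistory

variable {V : Type*} [DecidableEq V] (G : SimpleGraph V) (ι : Site 2 → V)

/-! ## The single-edge scheme along a planar macro-lattice `ι : ℤ² → V` -/

/-- The edge of `G` examined for the directed macro-edge `e`: `{ι e.1, ι (tgt e)}`. [folklore] -/
def coordOf (e : Site 2 × MDir) : Sym2 V := s(ι e.1, ι (tgt e))

/-- The envelope of the examination along `e` after history `h`: that edge, unless already revealed (it never is along a run; the subtraction
makes freshness hold after EVERY history). [folklore] -/
def edgeEnv (h : ProbeHistory V) (e : Site 2 × MDir) : Finset (Sym2 V) := {coordOf ι e} \ supp h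

/-- Success of the examination: every examined edge is observed open (KN's (4) with `ε = 1 - p`). [folklore] -/
def edgeSucc (h : ProbeHistory V) (e : Site 2 × MDir) (o : Finset (Sym2 V)) : Prop := edgeEnv ι h e ⊆ o

/-- The next probe: the static examination of the chosen candidate, whenever there is one (KN's (3)). [folklore] -/
def edgeNext (h : ProbeHistory V) : Option (AProbe V) :=
  match (mstOf (edgeSucc ι) h).choice with
  | none => none
  | some e => some (AProbe.ofStatic (edgeEnv ι h e))

/-- **The single-edge exploration scheme** along `ι` (an exploration process in the sense of KN §4 p. 25 with cells = single vertices; `U₀ = ∅`).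
[folklore] -/
def edgeScheme : HSiteScheme V := ⟨⟨edgeNext ι⟩, ∅, edgeSucc ι⟩

variable {G ι}

/-- The envelope has at most the one edge of the examined macro-edge. [folklore] -/
theorem edgeEnv_subset (h : ProbeHistory V) (e : Site 2 × MDir) : edgeEnv ι h e ⊆ {coordOf ι e} := Finset.sdiff_subset

/-- If a probe is made, it is the static examination of the chosen candidate. [folklore] -/
theorem edgeNext_eq_some {h : ProbeHistory V} {P : AProbe V} (hP : (edgeScheme ι).E.next h = some P) :
    ∃ e, (mstOf (edgeSucc ι) h).choice = some e ∧ P = AProbe.ofStatic (edgeEnv ι h e) := by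
  change edgeNext ι h = some P at hP
  unfold edgeNext at hP
  cases hc : (mstOf (edgeSucc ι) h).choice with
  | none => rw [hc] at hP; exact absurd hP (by simp)
  | some e => rw [hc] at hP; exact ⟨e, rfl, (Option.some.inj hP).symm⟩

/-- **The single-edge scheme is lawful on `G` at `(p, 1 - p)`, for every `p`**, as soon as `ι` carries macro-steps to edges of `G`.
[cite: KozmaNitzan2024, §4 p. 25 (Definition of an exploration process)] -/
theorem edgeScheme_lawful (hadj : ∀ e : Site 2 × MDir, G.Adj (ι e.1) (ι (tgt e))) (p : unitInterval) :
    (edgeScheme ι).Lawful G p (1 - p) where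
  fresh := by
    intro h P hP
    obtain ⟨e, -, rfl⟩ := edgeNext_eq_some hP
    show Disjoint ((edgeEnv ι h e : Finset (Sym2 V)) : Set (Sym2 V)) ((∅ : Finset (Sym2 V)) : Set (Sym2 V)) ∧ Disjoint (edgeEnv ι h e) (supp h)
    rw [Finset.coe_empty]
    exact ⟨disjoint_bot_right, Finset.sdiff_disjoint⟩
  probes := by
    intro ω _ n hc
    change edgeNext ι ((edgeScheme ι).E.hist n ω) ≠ none
    unfold edgeNext
    cases hc' : (mstOf (edgeSucc ι) ((edgeScheme ι).E.hist n ω)).choice with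
    | none => exact absurd hc' hc
    | some e => simp
  fail := by
    intro h P e hP hc
    obtain ⟨e', hc', rfl⟩ := edgeNext_eq_some hP
    have hee : e' = e := by
      change (mstOf (edgeSucc ι) h).choice = some e at hc
      rw [hc'] at hc
      exact Option.some.inj hc
    subst hee
    have hsub : {ω : BondConfig V | ¬(edgeScheme ι).succ h e' ((AProbe.ofStatic (edgeEnv ι h e')).read ω)} ⊆ {ω | coordOf ι e' ∉ ω} := by
      intro ω hω hmem
      apply hω
      change edgeEnv ι h e' ⊆ obs ω (edgeEnv ι h e')
      rw [SiteSameP.subset_obs_self_iff]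
      intro x hx
      rw [Finset.mem_singleton.1 (edgeEnv_subset h e' hx)]
      exact hmem
    have hc_edge : coordOf ι e' ∈ G.edgeSet := (SimpleGraph.mem_edgeSet G).2 (hadj e')
    calc (bondPercolation G p).real {ω | ¬(edgeScheme ι).succ h e' ((AProbe.ofStatic (edgeEnv ι h e')).read ω)}
        ≤ (bondPercolation G p).real {ω | coordOf ι e' ∉ ω} := measureReal_mono hsub
      _ = 1 - p := by
        have hcpl : {ω : BondConfig V | coordOf ι e' ∉ ω} = {ω | coordOf ι e' ∈ ω}ᶜ := rfl
        rw [hcpl, measureReal_compl (measurableSet_mem _), probReal_univ, bondPercolation_cylinder G p hc_edge]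

/-- Every envelope has at most one edge. [folklore] -/
theorem card_env_le_one (h : ProbeHistory V) (P : AProbe V) (hP : (edgeScheme ι).E.next h = some P) : P.env.card ≤ 1 := by
  obtain ⟨e, -, rfl⟩ := edgeNext_eq_some hP
  calc (AProbe.ofStatic (edgeEnv ι h e)).env.card = (edgeEnv ι h e).card := rfl
    _ ≤ ({coordOf ι e} : Finset _).card := Finset.card_le_card (edgeEnv_subset h e)
    _ = 1 := Finset.card_singleton _

/-! ## The run: occupied macro-vertices are joined to `ι 0` by open edges -/

/-- **The run invariant** (for injective `ι` carrying macro-steps to edges): every occupied macro-vertex is carried by `ι` into the open cluster of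
`ι 0`, and every revealed edge is `{ι a, ι b}` for two DETERMINED macro-vertices `a, b` — so the edge of a candidate (whose target is undetermined)
is always fresh. [folklore] -/
theorem run_inv (hι : Function.Injective ι) (hadj : ∀ e : Site 2 × MDir, G.Adj (ι e.1) (ι (tgt e))) (ω : BondConfig V) : ∀ n : ℕ,
    (∀ v ∈ ((edgeScheme ι).stN n ω).occ, ι v ∈ openCluster ω (ι 0)) ∧
    (∀ c ∈ supp ((edgeScheme ι).E.hist n ω), ∃ a b, ((edgeScheme ι).stN n ω).Det a ∧ ((edgeScheme ι).stN n ω).Det b ∧ c = s(ι a, ι b)) := by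
  intro n
  induction n with
  | zero =>
    refine ⟨fun v hv => ?_, fun c hc => ?_⟩
    · have hv0 : v = 0 := by simpa [HSiteScheme.stN, HSiteScheme.mst, HState.start] using hv
      subst hv0
      exact mem_openCluster_self _ _
    · simp at hc
  | succ n ih =>
    obtain ⟨ih1, ih2⟩ := ih
    set S := edgeScheme ι with hS
    cases hD : S.E.next (S.E.hist n ω) with
    | none =>
      rw [S.stN_succ_of_next_none hD, AExplorer.hist_succ, S.E.step_of_none hD, supp_cons_none]
      exact ⟨ih1, ih2⟩
    | some P =>
      obtain ⟨e, hc, hPe⟩ := edgeNext_eq_some hD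
      have hc' : (S.stN n ω).choice = some e := hc
      obtain ⟨he1, he2⟩ := HState.cand_of_choice hc'
      -- the examined edge is fresh
      have hfresh : coordOf ι e ∉ supp (S.E.hist n ω) := by
        intro hq
        obtain ⟨a, b, ha, hb, hab⟩ := ih2 _ hq
        rcases Sym2.eq_iff.1 hab with ⟨_, h2⟩ | ⟨_, h2⟩
        · exact he2 (hι h2 ▸ hb)
        · exact he2 (hι h2 ▸ ha)
      have henv : edgeEnv ι (S.E.hist n ω) e = {coordOf ι e} := by
        rw [edgeEnv, Finset.sdiff_eq_self_iff_disjoint]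
        exact Finset.disjoint_singleton_left.2 hfresh
      have hsucc : S.succ (S.E.hist n ω) e (P.read ω) ↔ s(ι e.1, ι (tgt e)) ∈ ω := by
        rw [hPe, AProbe.read_ofStatic]
        change edgeEnv ι (S.E.hist n ω) e ⊆ obs ω (edgeEnv ι (S.E.hist n ω) e) ↔ _
        rw [SiteSameP.subset_obs_self_iff, henv]
        simp [coordOf]
      have hst : S.stN (n + 1) ω = (S.stN n ω).update e (S.succ (S.E.hist n ω) e (P.read ω)) := by
        rw [S.stN_succ_of_next_some hD, hc']
      have hsupp : ∀ c ∈ supp (S.E.hist (n + 1) ω), c = coordOf ι e ∨ c ∈ supp (S.E.hist n ω) := by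
        intro c hcs
        rw [AExplorer.hist_succ, S.E.step_of_some hD] at hcs
        obtain ⟨r, hr, hcr⟩ := mem_supp_iff.1 hcs
        rcases List.mem_cons.1 hr with hr | hr
        · left
          have hr' : r = P.record ω := Option.some.inj hr
          have hrec : (P.record ω).1 = P.reveal ω := rfl
          rw [hr', hrec, hPe, AProbe.reveal_ofStatic, henv, Finset.mem_singleton] at hcr
          exact hcr
        · exact Or.inr (mem_supp_iff.2 ⟨r, hr, hcr⟩)
      refine ⟨fun v hv => ?_, fun c hcs => ?_⟩
      · rw [hst] at hv
        by_cases hok : S.succ (S.E.hist n ω) e (P.read ω)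
        · rw [(S.stN n ω).update_of_ok e _ hok] at hv
          rcases Finset.mem_insert.1 hv with rfl | hv
          · have hopen : s(ι e.1, ι (tgt e)) ∈ ω := hsucc.1 hok
            refine SimpleGraph.Reachable.trans (ih1 _ he1) (SimpleGraph.Adj.reachable ?_)
            rw [openGraph_adj]
            exact ⟨hopen, (hadj e).ne⟩
          · exact ih1 v hv
        · rw [(S.stN n ω).update_of_not_ok e _ hok] at hv
          exact ih1 v hv
      · rw [hst]
        rcases hsupp c hcs with rfl | hcs
        · exact ⟨e.1, tgt e, (S.stN n ω).det_update_of_det e _ (Or.inl he1), (S.stN n ω).det_update_tgt e _, rfl⟩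
        · obtain ⟨a, b, ha, hb, rfl⟩ := ih2 _ hcs
          exact ⟨a, b, (S.stN n ω).det_update_of_det e _ ha, (S.stN n ω).det_update_of_det e _ hb, rfl⟩

/-- **An infinite final macro-cluster forces `ι 0 ↔ ∞`** (surely): the occupied macro-vertices are carried injectively into the open cluster of
`ι 0`. [cite: KozmaNitzan2024, §4 p. 25] -/
theorem mem_percolatesAt_of_infinite (hι : Function.Injective ι) (hadj : ∀ e : Site 2 × MDir, G.Adj (ι e.1) (ι (tgt e)))
    {ω : BondConfig V} (hinf : ((edgeScheme ι).occFinal ω).Infinite) : ω ∈ percolatesAt (ι 0) := by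
  change (openCluster ω (ι 0)).Infinite
  have hsub : ι '' (edgeScheme ι).occFinal ω ⊆ openCluster ω (ι 0) := by
    rintro _ ⟨v, hv, rfl⟩
    obtain ⟨n, hn⟩ := Set.mem_iUnion.1 hv
    exact (run_inv hι hadj ω n).1 v hn
  exact (hinf.image hι.injOn).mono hsub

/-! ## The input at density one -/

/-- **The witness clause of `SameP.SamePWitness G (ι 0)` at every density `p` with `1 - p < 2⁻³²`** (in particular at `p = 1`), on any graph
carrying a planar macro-lattice `ι`. [cite: KozmaNitzan2024, §4 p. 25 (Definition of an exploration process)] -/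
theorem samePWitness_clause_of_near_one (hι : Function.Injective ι) (hadj : ∀ e : Site 2 × MDir, G.Adj (ι e.1) (ι (tgt e)))
    (p : unitInterval) (hp : 1 - (p : ℝ) < (1 / 2) ^ 32) :
    ∃ (S : HSiteScheme V) (ε : ℝ) (N : ℕ), S.Lawful G p ε ∧ ε < (1 / 2) ^ 32 ∧
      (∀ h P, S.E.next h = some P → P.env.card ≤ N) ∧ (↑S.U₀ : Set (Sym2 V)) ⊆ G.edgeSet ∧
      S.initEvent ∩ {ω | (S.occFinal ω).Infinite} ⊆ percolatesAt (ι 0) ∪ {ω | ¬ω ⊆ G.edgeSet} :=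
  ⟨edgeScheme ι, 1 - p, 1, edgeScheme_lawful hadj p, hp, card_env_le_one,
    by change ((∅ : Finset (Sym2 V)) : Set (Sym2 V)) ⊆ G.edgeSet; rw [Finset.coe_empty]; exact Set.empty_subset _,
    fun _ hω => Or.inl (mem_percolatesAt_of_infinite hι hadj hω.2)⟩

/-- **`SamePWitnessLtOne G (ι 0) → SamePWitness G (ι 0)`** on any graph carrying a planar macro-lattice through the base vertex.
[cite: KozmaNitzan2024, §4 p. 25] -/
theorem samePWitness_of_ltOne (hι : Function.Injective ι) (hadj : ∀ e : Site 2 × MDir, G.Adj (ι e.1) (ι (tgt e)))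
    (h : SameP.SamePWitnessLtOne G (ι 0)) : SameP.SamePWitness G (ι 0) := by
  intro p hθ
  rcases p.2.2.lt_or_eq with hp1 | hp1
  · exact h p hp1 hθ
  · exact samePWitness_clause_of_near_one hι hadj p (by rw [hp1]; norm_num)

/-- The two inputs are equivalent on such graphs. [folklore] -/
theorem samePWitness_iff_ltOne (hι : Function.Injective ι) (hadj : ∀ e : Site 2 × MDir, G.Adj (ι e.1) (ι (tgt e))) :
    SameP.SamePWitness G (ι 0) ↔ SameP.SamePWitnessLtOne G (ι 0) :=
  ⟨SameP.samePWitnessLtOne_of_samePWitness G (ι 0), samePWitness_of_ltOne hι hadj⟩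

/-! ## `ℤ^d` -/

/-- **INPUT (FSW) HOLDS for `ℤ^d`, `d ≥ 3`, with NO restriction on the density**: `SameP.SamePWitness (zdGraph d) 0` (below one:
`SameP.samePWitnessLtOne_zd`, Kozma–Nitzan §4 from the tree's Conjecture 3; at one: the single-edge scheme along the planar embedding
`SiteSameP.planarEmb`). [cite: KozmaNitzan2024, §4 Theorem 6 (pp. 25–31)] -/
theorem samePWitness_zd {d : ℕ} (hd : 3 ≤ d) : SameP.SamePWitness (zdGraph d) (0 : Site d) := by
  have hd2 : 2 ≤ d := by omega
  have h := samePWitness_of_ltOne (G := zdGraph d) (ι := SiteSameP.planarEmb d) (SiteSameP.planarEmb_injective hd2)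
    (SiteSameP.planarEmb_adj_tgt hd2)
  rw [SiteSameP.planarEmb_zero] at h
  exact h (SameP.samePWitnessLtOne_zd d hd)

/-! ## Products `X □ ℤ²` (the lane's central graph class): the fibre `{w} × ℤ²` is a planar macro-lattice -/

/-- The fibre embedding `v ↦ (w, v)` of `ℤ²` into `X □ ℤ²` carries macro-steps to edges. [folklore] -/
theorem boxProdZ2_fibre_adj {W : Type*} (X : SimpleGraph W) (w : W) (e : Site 2 × MDir) :
    (X □ zdGraph 2).Adj (w, e.1) (w, tgt e) := by
  rw [SimpleGraph.boxProd_adj]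
  refine Or.inr ⟨?_, rfl⟩
  rw [zdGraph_adj_iff_stepVec]
  exact ⟨e.2, rfl⟩

/-- **On every product `X □ ℤ²` the unrestricted input at `(w, 0)` is equivalent to its restriction below one** (the witness at densities
`p` with `1 - p < 2⁻³²` is the single-edge scheme along the fibre `{w} × ℤ²`). [cite: KozmaNitzan2024, §4 p. 25] -/
theorem samePWitness_boxProdZ2_iff_ltOne {W : Type*} [DecidableEq W] (X : SimpleGraph W) (w : W) :
    SameP.SamePWitness (X □ zdGraph 2) (w, (0 : Site 2)) ↔ SameP.SamePWitnessLtOne (X □ zdGraph 2) (w, (0 : Site 2)) :=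
  samePWitness_iff_ltOne (G := X □ zdGraph 2) (ι := fun v : Site 2 => (w, v)) (fun _ _ h => (Prod.mk.inj h).2)
    (boxProdZ2_fibre_adj X w)

end SamePAtOne

end Summit.CriticalPhenomena.PercolationContinuityZ3.Theorems.Transplant

end
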